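import Literature.NumberTheory.EllipticCurves.AnticyclotomicSignedTransferTheorem
import HarnessLib

/-!
# Castella–Wan 2024, proof of Thm. 6.8 (MS p. 30): the sentence
# "`Sel_±(K, 𝐓^ac) = Sel_{±,rel}(K, 𝐓^ac)`" under the rank hypotheses of (i) — ONE named fact
# (statement only, PROVED in print), in the vocabulary of `AnticyclotomicSignedTransferInputs`

Topic `Literature/NumberTheory/EllipticCurves`; namespace `Literature.NumberTheory.EllipticCurves.AcSigned`
(the object namespace of the series `AnticyclotomicSignedSelmer.lean`, `AnticyclotomicSignedCompactSelmer.lean`,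
`AnticyclotomicSignedLocalConditions.lean`, `AnticyclotomicSignedLocalisation.lean`,
`AnticyclotomicSignedTransferInputs.lean`, `AnticyclotomicSignedTransferTheorem.lean`). Written by the width
seat bsd-line-sbc-p1-w2 (gen 5) of the BSD summit's route `SignedBaseChange`, crux
`AnticyclotomicEisensteinDivisibility` (stmt-BirchSwinnertonDyer-20727), for the EISENSTEIN-direction transfer
of Castella–Wan's Thm. 6.8 (`Summits/…/Theorems/SignedBaseChangeAnticyclotomicEisensteinDivisibilityEisensteinTransfer.lean`):
the sibling structure `TransferInputs` records (module docstring there, "NOT fields") that the printed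
identification "`Sel_±(K, 𝐓^ac) = Sel^{±,rel}(K, 𝐓^ac)`" is not one of its six fields because the `⊇`-transfer
survives without it; the `⊆`-transfer (the direction the BDP-currency Eisenstein half consumes) does NOT —
it needs the two cokernels `coker(loc_𝔭 | Sel_±)`, `coker(loc_𝔭 | Sel^{±,rel})` to agree. This file gives that
printed sentence a Lean name, with the hypotheses under which print derives it. Typed ≠ proved ≠ endorsed;
the Birch–Swinnerton-Dyer conjecture is not advanced by this file.

## Source, VERBATIM (authors' accepted MS `paper:url-7157bd4f7b88`, p. 30 = journal p. 2624)

Proof of Thm. 6.8: "Since `H¹_±(K_𝔭, 𝐓^ac) ≃ Λ^ac` (see Proposition 3.8), by Theorem 6.2 the equivalence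
between ranks in parts (i) and (ii) follows easily from (6.12). Indeed, if both `X^{rel,str}` and
`Sel^{str,rel}(K, 𝐓^ac)` are `Λ^ac`-torsion, then (6.12) shows that `Sel^{±,rel}(K, 𝐓^ac)` has `Λ^ac`-rank one,
and since by Lemma 4.7 and Corollary 6.4 the submodule `Sel_±(K, 𝐓^ac) ⊂ Sel^{±,rel}(K, 𝐓^ac)` contains the
non-torsion class `z^±_∞`, it follows that `Sel_±(K, 𝐓^ac)` has rank one, and therefore so does `X_±` by Lemma
6.7(1). The other implication for `Λ^ac`-ranks is similar. As for the relation between divisibilities in (i)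
and (ii), note that it follows from the preceding paragraph that either of the rank hypotheses in (i) or (ii)
implies that both `Sel_±(K, 𝐓^ac)` and `Sel^{±,rel}(K, 𝐓^ac)` have `Λ^ac`-rank one, and hence `Sel_±(K, 𝐓^ac) =
Sel^{±,rel}(K, 𝐓^ac)`, since the quotient `Sel^{±,rel}(K, 𝐓^ac)/Sel_±(K, 𝐓^ac)` injects into `H¹(K_𝔭̄,
𝐓^ac)/H¹_±(K_𝔭̄, 𝐓^ac)`, which has trivial `Λ^ac`-torsion by Proposition 3.8. The map `loc_𝔭` in (6.12) is
therefore the same as the one in the exact sequence (6.13)". Thm. 6.8 (i) (MS p. 30): "Both `Sel_±(K, 𝐓^ac)`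
and `X_±` have `Λ^ac`-rank one, and …". Prop. 3.8 (MS p. 15): "`0 → H¹_±(ℚ_p, 𝐓_𝔭) → H¹(ℚ_p, 𝐓_𝔭) —Col^±→ Λ →
0` … In particular, `H¹_±` are free `Λ`-modules of rank `1`". §6 STANDING (MS p. 25): "Let `E/ℚ` be an
elliptic curve of conductor `N`, `f ∈ S₂(Γ₀(N))` the newform associated with `E`, `p > 3` a prime of good
supersingular reduction for `E`, and `K` an imaginary quadratic field satisfying hypotheses (gen-H) and (spl)".

## What is typed (one `def … : Prop`, nothing asserted)

`castellaWan2024_proofThm68_selmerRel_le_selmerSgn` — SPECIAL CASE and binder block EXACTLY those of the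
sibling `castellaWan2024_proofThm68_transferInputs` (`AcSigned.Setting W K p κ 𝔭 𝔭'`: `a_p = 0`, `p = 𝔭𝔭'`
split, `κ` anticyclotomic, `p ∤ h_K` hence one prime of `K_∞` above `𝔭`; `N⁻ = 1` as
`SatisfiesHeegnerHypothesis N K`; `f` the newform of `W` of level `N = N_E`; `3 < p` VERBATIM; an embedding
datum `ι` inducing `𝔭`; `γ` a topological generator), the RANK HYPOTHESES OF (i) as
`finrank_Λ Sel_ε(K, 𝐓^ac) = 1` (for the structure `selmerLambdaAdic.moduleOfGen`; no finite generation
recorded) and `X.HasRank … (sgn ε) … 1`; CONCLUSION: the compact Selmer group with the signed condition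
`ε` at `𝔭` and NO condition at `𝔭'` — `selmerLambdaAdic (W⁄K) p κ γ (PCond.at 𝔭' .rel (.sgn ε))`, the object
standing for print's `Sel^{±,rel}(K, 𝐓^ac)` in field `exact612` of `TransferInputs` — is CONTAINED in the
signed one `selmerLambdaAdic (W⁄K) p κ γ (fun _ ↦ .sgn ε)` (the converse containment is the tree theorem
`selmerLambdaAdic_sgn_le_at_rel`, so this is print's equality). WEAKER than print, never stronger (print
derives it from either (i)'s or (ii)'s rank hypotheses; only (i)'s are offered). NOT usable at `p = 3`
(printed `p > 3`). Reading flags inherited unchanged from the sibling files (`CW24-local-condition`,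
`away-p`, `str-vs-loc-zero`, `tot-ram-via-h_K`, `delta-zero`): they fix which tree objects stand for
`Sel_±(K, 𝐓^ac)` and `Sel^{±,rel}(K, 𝐓^ac)`; this file adds none. The converse
containment being the tree's `selmerLambdaAdic_sgn_le_at_rel`, consumers get print's EQUALITY by `le_antisymm`.

Consumer: `Summit.…Theorems.SignedBaseChangeAcDivS1OfSignedEisenstein.bdpLowerHalfRatSS_coprime_of_signedEisenstein`
(hypothesis `hRel`, stated there by value with this exact body).

## References
* [CastellaWan2023] F. Castella, X. Wan, *Perrin-Riou's main conjecture for elliptic curves at supersingular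
  primes*, Math. Ann. 389 (2024) 2595–2636; accepted MS `paper:url-7157bd4f7b88`, proof of Thm. 6.8 (MS p. 30),
  Prop. 3.8 (MS p. 15), §6 standing hypotheses (MS p. 25).
* [BDKim2007] B. D. Kim, Compos. Math. 143 (2007), §4 Prop. 4.11 (the local input of Lemma 6.7, `p > 3`).
-/

noncomputable section

open scoped Classical

open PowerSeries NumberField IsDedekindDomain Field
open Literature.NumberTheory.EllipticCurves Literature.NumberTheory.GaloisRepresentations
open Literature.NumberTheory.EllipticCurves.ModularForms Literature.NumberTheory.EllipticCurves.Castella2018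

namespace Literature.NumberTheory.EllipticCurves.AcSigned

section Facts

variable (N : ℕ) [NeZero N] (W : WeierstrassCurve ℚ) [W.IsGloballyMinimal] (K : Type) [Field K]
  [NumberField K] (p : ℕ) [Fact p.Prime] (κ : ZpExtension K p) (𝔭 𝔭' : HeightOneSpectrum (𝓞 K))

/-- **Castella–Wan 2024, proof of Thm. 6.8 (MS p. 30): `Sel_±(K, 𝐓^ac) = Sel_{±,rel}(K, 𝐓^ac)` under the rank
hypotheses of (i); named fact (statement only; PROVED in print).** PRINT (MS p. 30): "it follows from the
preceding paragraph that either of the rank hypotheses in (i) or (ii) implies that both `Sel_±(K, 𝐓^ac)` and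
`Sel_{±,rel}(K, 𝐓^ac)` have `Λ^ac`-rank one, and hence `Sel_±(K, 𝐓^ac) = Sel_{±,rel}(K, 𝐓^ac)`, since the
quotient `Sel_{±,rel}(K, 𝐓^ac)/Sel_±(K, 𝐓^ac)` injects into `H¹(K_𝔭̄, 𝐓^ac)/H¹_±(K_𝔭̄, 𝐓^ac)`, which has trivial
`Λ^ac`-torsion by Proposition 3.8", with (i)'s rank hypotheses "Both `Sel_±(K, 𝐓^ac)` and `X_±` have
`Λ^ac`-rank one". STANDING (§6, MS p. 25): `E/ℚ` of conductor `N` with newform `f`, `p > 3` good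
supersingular, `K` imaginary quadratic with (gen-H) and (spl), `𝔭 ∣ p` induced by `ι_p`. TYPED (module
docstring): in `AcSigned.Setting` (`a_p = 0`, `p = 𝔭𝔭'` split, `κ` anticyclotomic, `p ∤ h_K`), `N⁻ = 1`, `f`
the newform of `W` of level `N = N_E`, `3 < p` VERBATIM, `ι` inducing `𝔭`, `γ` a topological generator;
rank hypotheses of (i) as `finrank_Λ Sel_ε(K, 𝐓^ac) = 1` and `X.HasRank … (sgn ε) … 1`; conclusion
`Sel^{ε, rel at 𝔭'}(K, 𝐓^ac) ≤ Sel_ε(K, 𝐓^ac)` on the tree's compact carriers (the converse is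
`selmerLambdaAdic_sgn_le_at_rel`). WEAKER than print, never stronger. NOT usable at `p = 3`.
PUBLISHED (refereed), proved in print.
[cite: CastellaWan2023, proof of Thm. 6.8 (MS p. 30), Thm. 6.8 (i) (MS p. 30), Prop. 3.8 (MS p. 15), §6 standing hypotheses (MS p. 25)] -/
def castellaWan2024_proofThm68_selmerRel_le_selmerSgn : Prop :=
  ∀ (_ : Setting W K p κ 𝔭 𝔭') (ι : PadicAlgCl p ≃+* ℂ) {f : CuspForm (CongruenceSubgroup.Gamma0 N) 2}
    (_ : IsNewformOf W f), (W.conductorNorm ℤ : ℕ) = N → SatisfiesHeegnerHypothesis N K → 3 < p →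
    (∀ (w : InfinitePlace K) (k : 𝓞 K), k ∈ 𝔭.asIdeal ↔ ‖ι.symm (w.embedding (k : K))‖ < 1) →
    ∀ (γ : absoluteGaloisGroup K) (hγ : κ.IsTopGenerator γ) (ε : ℤˣ),
      (letI := selmerLambdaAdic.moduleOfGen (W.baseChange K) p κ γ hγ (fun _ ↦ PCond.sgn ε)
       Module.finrank (IwasawaAlgebra p) (selmerLambdaAdic (W.baseChange K) p κ γ (fun _ ↦ .sgn ε)) = 1) →
      X.HasRank (W.baseChange K) p κ ∅ (fun _ ↦ .sgn ε) hγ 1 →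
      selmerLambdaAdic (W.baseChange K) p κ γ (PCond.at 𝔭' .rel (.sgn ε)) ≤
        selmerLambdaAdic (W.baseChange K) p κ γ (fun _ ↦ .sgn ε)

end Facts

end Literature.NumberTheory.EllipticCurves.AcSigned

end
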